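import Summits.Ventures.PercRepro.CogirthRLS

/-!
# PercRepro — the coloop-weighted double count and the criteria below the hyperplanes (p9, gen 17)

Notation (`CogirthRLS`): `c_u = levelCount M u = #{A ⊆ E : ρ(A) = u}`, `x(A) = #extSet M A = #(E ∖ cl A)` (the
rank-increasing elements), and here `κ(A) = #coloopSet M A` = the coloops of `M|A` (the elements whose removal
drops the rank).

THE KEY INEQUALITY (`sum_weight_le_levelCount`, exact and unconditional):
`Σ_{ρ(A) = u} x(A)/(κ(A) + 1) ≤ c_{u+1}` — every rank-`(u+1)` set `A'` with a coloop hands `1/κ(A')` to each pair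
`(A' ∖ e, e)`, `e` a coloop; these pairs are exactly the pairs `(A, e)` with `ρ(A) = u`, `e ∉ cl(A)`, and
`κ(A ∪ e) = κ(A) + 1` (`coloopSet_insert`). `CogirthRLS` used `κ(A') ≤ u + 1` instead and lost the slack of the
dependent sets.

THE CHAIN NEEDS THE LEVELS `q ≤ u ≤ p − 2` ONLY (`levelCount_mul_choose_of_step`, `rls_of_step`): the band
`q < ρ < p` ends at `p − 1`, so the hyperplane level is free. Hence:
* `rls_of_weighted` — **C-025 at `(p, q)` whenever `(p + q − u)·c_u ≤ (u + 1)·Σ_{ρ(A) = u} x(A)/(κ(A)+1)` for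
  `q ≤ u ≤ p − 2`**, and its per-set form `rls_of_weightedDeficient`:
  `(p + q − ρ(A))·(κ(A) + 1) ≤ (ρ(A) + 1)·x(A)` for every `A` with `q ≤ ρ(A) ≤ p − 2` (rank deficiency is the
  case `κ(A) = ρ(A)` of an independent `A`; a set with few coloops needs proportionally fewer rank-increasing
  elements). `RankDistColines` derives from it rank deficiency below the hyperplanes and the coline criterion.
On `T_p(B ⊕ U_{m,m})` every rank-`(u+1)` set has a coloop, so the key inequality is an equality there and the
weighted criterion is exactly the one-step inequality `(p + q − u)·c_u ≤ (u + 1)·c_{u+1}`.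
Nothing here is a statement about any window of the crux: every theorem is a criterion on the matroid.
-/

namespace PercRepro.RankDist

open Set Finset Matroid

variable {α : Type}

/-! ### Coloops of a restriction -/

/-- The coloops of `M|A`: the elements `e ∈ A ∩ E` whose removal drops the rank of `A`. -/
noncomputable def coloopSet (M : Matroid α) [M.Finite] (A : Set α) : Finset α :=
  (M.ground_finite.inter_of_left {e | e ∈ A ∧ M.eRk (A \ {e}) < M.eRk A}).toFinset

/-- Membership in `coloopSet`. -/
lemma mem_coloopSet (M : Matroid α) [M.Finite] {A : Set α} {e : α} :
    e ∈ coloopSet M A ↔ e ∈ M.E ∧ e ∈ A ∧ M.eRk (A \ {e}) < M.eRk A := by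
  rw [coloopSet, Set.Finite.mem_toFinset, Set.mem_inter_iff, mem_setOf_eq]

/-- Removing one element drops the rank by at most one. -/
lemma eRk_le_eRk_diff_singleton_add_one (M : Matroid α) (A : Set α) {e : α} (he : e ∈ A) :
    M.eRk A ≤ M.eRk (A \ {e}) + 1 := by
  have := M.eRk_insert_le_add_one e (A \ {e})
  rwa [Set.insert_sdiff_singleton, Set.insert_eq_of_mem he] at this

/-- For a set of rank `u + 1` the coloops are the elements whose removal drops the rank to `u`. -/
lemma coloopSet_eq_dropSet (M : Matroid α) [M.Finite] {A : Set α} (hA : A ⊆ M.E) {u : ℕ}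
    (hu : rk M A = u + 1) : coloopSet M A = dropSet M A u := by
  ext e
  rw [mem_coloopSet, mem_dropSet]
  constructor
  · rintro ⟨heE, heA, hlt⟩
    refine ⟨heE, heA, ?_⟩
    have h1 := eRk_le_eRk_diff_singleton_add_one M A heA
    rw [eRk_eq_coe_rk M hA, eRk_eq_coe_rk M (Set.sdiff_subset.trans hA), hu] at hlt h1
    have hlt' : rk M (A \ {e}) < u + 1 := by exact_mod_cast hlt
    have h1' : u + 1 ≤ rk M (A \ {e}) + 1 := by exact_mod_cast h1
    omega
  · rintro ⟨heE, heA, hrk⟩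
    refine ⟨heE, heA, ?_⟩
    rw [eRk_eq_coe_rk M hA, eRk_eq_coe_rk M (Set.sdiff_subset.trans hA), hrk, hu]
    exact_mod_cast Nat.lt_succ_self u

/-- At most `ρ(A)` coloops. -/
lemma card_coloopSet_le (M : Matroid α) [M.Finite] {A : Set α} (hA : A ⊆ M.E) :
    (coloopSet M A).card ≤ rk M A := by
  rcases Nat.eq_zero_or_pos (rk M A) with h0 | hpos
  · rw [h0]
    apply Nat.le_of_eq
    rw [Finset.card_eq_zero, Finset.eq_empty_iff_forall_notMem]
    intro e he
    rw [mem_coloopSet] at he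
    have := he.2.2
    rw [eRk_eq_coe_rk M hA, h0] at this
    exact absurd this (by simp)
  · have hu : rk M A = (rk M A - 1) + 1 := by omega
    rw [coloopSet_eq_dropSet M hA hu]
    exact (card_dropSet_le M hA _ hu).trans (by omega)

/-- A rank-increasing element is not in the closure of `A`. -/
lemma notMem_closure_of_mem_extSet (M : Matroid α) [M.Finite] {A : Set α} (hA : A ⊆ M.E) {e : α}
    (he : e ∈ extSet M A) : e ∉ M.closure A := by
  intro hcl
  rw [mem_extSet] at he
  have h1 : M.closure (insert e A) = M.closure A := Matroid.closure_insert_eq_of_mem_closure hcl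
  have h2 : M.eRk (insert e A) = M.eRk A := by
    rw [← M.eRk_closure_eq (insert e A), h1, M.eRk_closure_eq]
  have h3 := he.2
  rw [h2, eRk_eq_coe_rk M hA] at h3
  have h4 : rk M A = rk M A + 1 := by exact_mod_cast h3
  omega

/-- **Adding a rank-increasing element adds exactly one coloop**: `K(A ∪ e) = K(A) ∪ {e}` for `e ∉ cl(A)`. -/
lemma coloopSet_insert [DecidableEq α] (M : Matroid α) [M.Finite] {A : Set α} (hA : A ⊆ M.E) {e : α}
    (he : e ∈ extSet M A) : coloopSet M (insert e A) = insert e (coloopSet M A) := by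
  have hnot : e ∉ A := notMem_of_mem_extSet M hA he
  have hecl : e ∉ M.closure A := notMem_closure_of_mem_extSet M hA he
  rw [mem_extSet] at he
  obtain ⟨heE, hrk⟩ := he
  have hins : insert e A ⊆ M.E := Set.insert_subset heE hA
  ext x
  rw [Finset.mem_insert, mem_coloopSet, mem_coloopSet]
  constructor
  · rintro ⟨hxE, hxA, hlt⟩
    by_cases hxe : x = e
    · exact Or.inl hxe
    · right
      have hxA' : x ∈ A := (Set.mem_insert_iff.1 hxA).resolve_left hxe
      refine ⟨hxE, hxA', ?_⟩
      have hecl' : e ∈ M.E \ M.closure (A \ {x}) :=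
        ⟨heE, fun h => hecl (M.closure_subset_closure Set.sdiff_subset h)⟩
      have h3 : insert e A \ {x} = insert e (A \ {x}) :=
        Set.insert_sdiff_of_notMem A (by simpa using Ne.symm hxe)
      rw [h3, Matroid.eRk_insert_eq_add_one hecl', hrk, eRk_eq_coe_rk M hA,
        eRk_eq_coe_rk M (Set.sdiff_subset.trans hA)] at hlt
      rw [eRk_eq_coe_rk M hA, eRk_eq_coe_rk M (Set.sdiff_subset.trans hA)]
      have hlt' : rk M (A \ {x}) + 1 < rk M A + 1 := by exact_mod_cast hlt
      exact_mod_cast (by omega : rk M (A \ {x}) < rk M A)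
  · rintro (hxe | ⟨hxE, hxA, hlt⟩)
    · subst hxe
      refine ⟨heE, Set.mem_insert _ _, ?_⟩
      rw [Set.insert_sdiff_self_of_notMem hnot, hrk, eRk_eq_coe_rk M hA]
      exact_mod_cast Nat.lt_succ_self _
    · have hxe : x ≠ e := fun h => hnot (h ▸ hxA)
      refine ⟨hxE, Set.mem_insert_of_mem _ hxA, ?_⟩
      have hecl' : e ∈ M.E \ M.closure (A \ {x}) :=
        ⟨heE, fun h => hecl (M.closure_subset_closure Set.sdiff_subset h)⟩
      have h3 : insert e A \ {x} = insert e (A \ {x}) :=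
        Set.insert_sdiff_of_notMem A (by simpa using Ne.symm hxe)
      rw [h3, Matroid.eRk_insert_eq_add_one hecl', hrk]
      rw [eRk_eq_coe_rk M hA, eRk_eq_coe_rk M (Set.sdiff_subset.trans hA)] at hlt ⊢
      have hlt' : rk M (A \ {x}) < rk M A := by exact_mod_cast hlt
      exact_mod_cast (by omega : rk M (A \ {x}) + 1 < rk M A + 1)

/-! ### The weighted double count -/

/-- The weight of a set: `x(A)/(κ(A) + 1)` — its rank-increasing elements, divided by one more than its coloops. -/
noncomputable def weight (M : Matroid α) [M.Finite] (A : Set α) : ℚ :=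
  ((extSet M A).card : ℚ) / ((coloopSet M A).card + 1 : ℚ)

/-- The rank-`u` subsets of `E`, as a finset (`levelCount M u` is its cardinality). -/
noncomputable def levelFin (M : Matroid α) [M.Finite] (u : ℕ) : Finset (Set α) :=
  (subsetsFin M).filter (fun A => rk M A = u)

/-- `levelCount` is the cardinality of `levelFin`. -/
lemma levelCount_eq_card_levelFin (M : Matroid α) [M.Finite] (u : ℕ) :
    levelCount M u = (levelFin M u).card := rfl

/-- Membership in `levelFin`. -/
lemma mem_levelFin (M : Matroid α) [M.Finite] {u : ℕ} {A : Set α} :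
    A ∈ levelFin M u ↔ A ⊆ M.E ∧ rk M A = u := by
  rw [levelFin, mem_filter, mem_subsetsFin]

/-- The weight of a rank-`u` set is the sum over its rank-increasing elements `e` of `1/κ(A ∪ e)`. -/
lemma weight_eq_sum (M : Matroid α) [M.Finite] {u : ℕ} {A : Set α} (hA : A ∈ levelFin M u) :
    weight M A = ∑ e ∈ extSet M A, (1 : ℚ) / ((dropSet M (insert e A) u).card : ℚ) := by
  classical
  rw [mem_levelFin] at hA
  rw [Finset.sum_congr rfl (g := fun _ => (1 : ℚ) / ((coloopSet M A).card + 1 : ℚ)) ?_]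
  · rw [Finset.sum_const, nsmul_eq_mul, weight, div_eq_mul_one_div]
  · intro e he
    have heE : e ∈ M.E := ((mem_extSet M).1 he).1
    have hins : insert e A ⊆ M.E := Set.insert_subset heE hA.1
    have hrk : rk M (insert e A) = u + 1 := by
      rw [rk_eq_iff M hins, ((mem_extSet M).1 he).2, eRk_eq_coe_rk M hA.1, hA.2]
      push_cast; rfl
    have hnot : e ∉ coloopSet M A := fun h => notMem_of_mem_extSet M hA.1 he ((mem_coloopSet M).1 h).2.1
    rw [← coloopSet_eq_dropSet M hins hrk, coloopSet_insert M hA.1 he, Finset.card_insert_of_notMem hnot]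
    push_cast; rfl

/-- **THE KEY INEQUALITY**: `Σ_{ρ(A) = u} x(A)/(κ(A) + 1) ≤ c_{u+1}`. Every rank-`(u+1)` set with a coloop hands
`1/κ` to each of its coloop-removals; the pairs `(A ∪ e, e)`, `ρ(A) = u`, `e ∉ cl(A)`, are among them. -/
theorem sum_weight_le_levelCount (M : Matroid α) [M.Finite] (u : ℕ) :
    ∑ A ∈ levelFin M u, weight M A ≤ (levelCount M (u + 1) : ℚ) := by
  classical
  set s : Finset (Σ _ : Set α, α) := (levelFin M u).sigma (fun A => extSet M A) with hs
  set t : Finset (Σ _ : Set α, α) := (levelFin M (u + 1)).sigma (fun A => dropSet M A u) with ht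
  set g : (Σ _ : Set α, α) → (Σ _ : Set α, α) := fun x => ⟨insert x.2 x.1, x.2⟩ with hg
  have h1 : ∑ A ∈ levelFin M u, weight M A
      = ∑ x ∈ s, (1 : ℚ) / ((dropSet M (insert x.2 x.1) u).card : ℚ) := by
    rw [hs, Finset.sum_sigma]
    exact Finset.sum_congr rfl fun A hA => weight_eq_sum M hA
  have hmem : ∀ x ∈ s, g x ∈ t := by
    intro x hx
    rw [hs, Finset.mem_sigma, mem_levelFin] at hx
    obtain ⟨⟨hxE, hxu⟩, hxe⟩ := hx
    have hnot : x.2 ∉ x.1 := notMem_of_mem_extSet M hxE hxe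
    rw [mem_extSet] at hxe
    rw [ht, Finset.mem_sigma, mem_levelFin, mem_dropSet]
    refine ⟨⟨Set.insert_subset hxe.1 hxE, ?_⟩, hxe.1, Set.mem_insert _ _, ?_⟩
    · rw [rk_eq_iff M (Set.insert_subset hxe.1 hxE), hxe.2, eRk_eq_coe_rk M hxE, hxu]
      push_cast; rfl
    · rw [Set.insert_sdiff_self_of_notMem hnot]; exact hxu
  have hinj : Set.InjOn g s := by
    intro x hx y hy hxy
    rw [Finset.mem_coe, hs, Finset.mem_sigma, mem_levelFin] at hx hy
    have hnx : x.2 ∉ x.1 := notMem_of_mem_extSet M hx.1.1 hx.2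
    have hny : y.2 ∉ y.1 := notMem_of_mem_extSet M hy.1.1 hy.2
    simp only [hg, Sigma.mk.inj_iff, heq_iff_eq] at hxy
    obtain ⟨hAB, hee⟩ := hxy
    rw [← hee] at hAB
    have hAB' : x.1 = y.1 := by
      rw [← Set.insert_sdiff_self_of_notMem hnx, hAB, Set.insert_sdiff_self_of_notMem (hee ▸ hny)]
    exact Sigma.ext hAB' (heq_of_eq hee)
  have h2 : ∑ x ∈ s, (1 : ℚ) / ((dropSet M (insert x.2 x.1) u).card : ℚ)
      ≤ ∑ y ∈ t, (1 : ℚ) / ((dropSet M y.1 u).card : ℚ) := by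
    have hsum := Finset.sum_image (f := fun y : (Σ _ : Set α, α) => (1 : ℚ) / ((dropSet M y.1 u).card : ℚ))
      (s := s) (g := g) hinj
    simp only [hg] at hsum
    rw [← hsum]
    refine Finset.sum_le_sum_of_subset_of_nonneg ?_ ?_
    · intro y hy
      rw [Finset.mem_image] at hy
      obtain ⟨x, hx, rfl⟩ := hy
      exact hmem x hx
    · intro y _ _
      positivity
  have h3 : ∑ y ∈ t, (1 : ℚ) / ((dropSet M y.1 u).card : ℚ) ≤ (levelCount M (u + 1) : ℚ) := by
    rw [ht, Finset.sum_sigma, levelCount_eq_card_levelFin, Finset.card_eq_sum_ones, Nat.cast_sum]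
    refine Finset.sum_le_sum fun A _ => ?_
    show ∑ _ ∈ dropSet M A u, (1 : ℚ) / ((dropSet M A u).card : ℚ) ≤ ((1 : ℕ) : ℚ)
    rw [Finset.sum_const, nsmul_eq_mul, Nat.cast_one]
    by_cases h : (dropSet M A u).card = 0
    · rw [h]; simp
    · rw [mul_one_div_cancel (by exact_mod_cast h)]
  rw [h1]
  exact h2.trans h3

/-! ### The chain at the levels `q ≤ u ≤ p − 2` -/

/-- Pascal's ratio along the rank distribution from the one-step inequalities at the levels `q … p − 2` alone:
`c_q·C(p+q, u) ≤ c_u·C(p+q, q)` for `q ≤ u ≤ p − 1`. -/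
theorem levelCount_mul_choose_of_step (M : Matroid α) [M.Finite] (p q : ℕ)
    (hstep : ∀ u, q ≤ u → u + 2 ≤ p → (p + q - u) * levelCount M u ≤ (u + 1) * levelCount M (u + 1)) :
    ∀ u, q ≤ u → u + 1 ≤ p → levelCount M q * (p + q).choose u ≤ levelCount M u * (p + q).choose q := by
  intro u hqu
  induction u, hqu using Nat.le_induction with
  | base => intro _; exact le_refl _
  | succ u hqu ih =>
    intro hup
    have ih' := ih (by omega)
    have hs := hstep u hqu (by omega)
    have hpas := Nat.choose_succ_right_eq (p + q) u
    have key : levelCount M q * (p + q).choose (u + 1) * (u + 1)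
        ≤ levelCount M (u + 1) * (p + q).choose q * (u + 1) := by
      calc levelCount M q * (p + q).choose (u + 1) * (u + 1)
          = levelCount M q * ((p + q).choose u * (p + q - u)) := by rw [mul_assoc, hpas]
        _ = (levelCount M q * (p + q).choose u) * (p + q - u) := by ring
        _ ≤ (levelCount M u * (p + q).choose q) * (p + q - u) := Nat.mul_le_mul_right _ ih'
        _ = ((p + q - u) * levelCount M u) * (p + q).choose q := by ring
        _ ≤ ((u + 1) * levelCount M (u + 1)) * (p + q).choose q := Nat.mul_le_mul_right _ hs
        _ = levelCount M (u + 1) * (p + q).choose q * (u + 1) := by ring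
    exact Nat.le_of_mul_le_mul_right key (by omega)

/-- **C-025 FROM THE ONE-STEP INEQUALITIES AT THE LEVELS `q … p − 2`**: if `(p + q − u)·c_u ≤ (u + 1)·c_{u+1}` for
every `q ≤ u ≤ p − 2`, then `ThmN.RLS M p q`. The hyperplane level `u = p − 1` is never used. -/
theorem rls_of_step (M : Matroid α) [M.Finite] (p q : ℕ)
    (hstep : ∀ u, q ≤ u → u + 2 ≤ p → (p + q - u) * levelCount M u ≤ (u + 1) * levelCount M (u + 1)) :
    ThmN.RLS M p q := by
  unfold ThmN.RLS phiK
  have hU := ncard_U_le_levelCount M p q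
  rw [ncard_Y_eq_sum M p q]
  have hpos : (0 : ℚ) < ((p + q).choose p : ℚ) := by
    exact_mod_cast Nat.choose_pos (by omega)
  rw [div_mul_eq_mul_div, div_le_iff₀ hpos]
  have key : (∑ u ∈ Ioo q p, (p + q).choose u)
      * {A : Set α | A ⊆ M.E ∧ M.eRk A = (p : ℕ∞) ∧ M.eRk (M.E \ A) = (q : ℕ∞)}.ncard
      ≤ (∑ u ∈ Ioo q p, levelCount M u) * (p + q).choose p := by
    calc (∑ u ∈ Ioo q p, (p + q).choose u)
          * {A : Set α | A ⊆ M.E ∧ M.eRk A = (p : ℕ∞) ∧ M.eRk (M.E \ A) = (q : ℕ∞)}.ncard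
        ≤ (∑ u ∈ Ioo q p, (p + q).choose u) * levelCount M q := Nat.mul_le_mul_left _ hU
      _ = ∑ u ∈ Ioo q p, levelCount M q * (p + q).choose u := by
          rw [Finset.sum_mul]; exact Finset.sum_congr rfl fun u _ => mul_comm _ _
      _ ≤ ∑ u ∈ Ioo q p, levelCount M u * (p + q).choose q := by
          refine Finset.sum_le_sum fun u hu => ?_
          rw [Finset.mem_Ioo] at hu
          exact levelCount_mul_choose_of_step M p q hstep u (by omega) (by omega)
      _ = (∑ u ∈ Ioo q p, levelCount M u) * (p + q).choose p := by
          rw [Finset.sum_mul, Nat.choose_symm_add]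
  exact_mod_cast key

/-! ### The weighted criterion -/

/-- The one-step inequality at level `u` from the weighted hypothesis
`(p + q − u)·c_u ≤ (u + 1)·Σ_{ρ(A) = u} x(A)/(κ(A) + 1)`. -/
theorem levelCount_step_of_weighted (M : Matroid α) [M.Finite] (p q u : ℕ)
    (hG : ((p + q - u : ℕ) : ℚ) * levelCount M u ≤ (u + 1 : ℚ) * ∑ A ∈ levelFin M u, weight M A) :
    (p + q - u) * levelCount M u ≤ (u + 1) * levelCount M (u + 1) := by
  have h := sum_weight_le_levelCount M u
  have h' : ((p + q - u : ℕ) : ℚ) * levelCount M u ≤ (u + 1 : ℚ) * levelCount M (u + 1) :=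
    hG.trans (mul_le_mul_of_nonneg_left h (by positivity))
  exact_mod_cast h'

/-- **C-025 UNDER THE WEIGHTED CRITERION**: if `(p + q − u)·c_u ≤ (u + 1)·Σ_{ρ(A) = u} x(A)/(κ(A) + 1)` for every
`q ≤ u ≤ p − 2`, then `ThmN.RLS M p q`. -/
theorem rls_of_weighted (M : Matroid α) [M.Finite] (p q : ℕ)
    (hG : ∀ u, q ≤ u → u + 2 ≤ p →
      ((p + q - u : ℕ) : ℚ) * levelCount M u ≤ (u + 1 : ℚ) * ∑ A ∈ levelFin M u, weight M A) :
    ThmN.RLS M p q :=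
  rls_of_step M p q fun u hqu hup => levelCount_step_of_weighted M p q u (hG u hqu hup)

/-- **Weighted rank deficiency at `(p, q)`** (below the hyperplanes): every `A ⊆ E` with `q ≤ ρ(A) ≤ p − 2`
satisfies `(p + q − ρ(A))·(κ(A) + 1) ≤ (ρ(A) + 1)·x(A)`, `x(A)` its rank-increasing elements, `κ(A)` its coloops.
Rank deficiency (`x(A) ≥ p + q − ρ(A)`) is the case of the independent sets (`κ(A) = ρ(A)`); a set with few
coloops needs proportionally fewer rank-increasing elements. -/
def WeightedDeficient (M : Matroid α) [M.Finite] (p q : ℕ) : Prop :=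
  ∀ A ⊆ M.E, q ≤ rk M A → rk M A + 2 ≤ p →
    (p + q - rk M A) * ((coloopSet M A).card + 1) ≤ (rk M A + 1) * (extSet M A).card

/-- **C-025 UNDER WEIGHTED RANK DEFICIENCY**. -/
theorem rls_of_weightedDeficient (M : Matroid α) [M.Finite] (p q : ℕ) (hdef : WeightedDeficient M p q) :
    ThmN.RLS M p q := by
  refine rls_of_weighted M p q fun u hqu hup => ?_
  rw [levelCount_eq_card_levelFin, Finset.mul_sum]
  have hconst : ((p + q - u : ℕ) : ℚ) * ((levelFin M u).card : ℚ)
      = ∑ A ∈ levelFin M u, ((p + q - u : ℕ) : ℚ) := by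
    rw [Finset.sum_const, nsmul_eq_mul, mul_comm]
  rw [hconst]
  refine Finset.sum_le_sum fun A hA => ?_
  rw [mem_levelFin] at hA
  have h := hdef A hA.1 (by omega) (by omega)
  rw [hA.2] at h
  rw [weight, ← mul_div_assoc, le_div_iff₀ (by positivity)]
  exact_mod_cast (by nlinarith [h] : (p + q - u) * ((coloopSet M A).card + 1) ≤ (u + 1) * (extSet M A).card)

end PercRepro.RankDist
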